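import Literature.MathematicalPhysics.QuantumFieldTheory.Balaban1983to89.B4StripSums

/-!
# `BalabanUV.Beta.GAN24.SubAveragingDirichlet` — binder row G-an2-4 ∕ (CONV-C), programme «SUBAVG-RATE»
# (ROUTES-GAN24 R2-S1∕S2 ∘ R3-S3 executed at `U = 1` in the fibre∕strip currency), FILE 1:
# THE ONE-COORDINATE DIRICHLET-KERNEL LEMMAS BEHIND THE SHARP ONE-STEP RATE `θ = L⁻²`

NOT IN PRINT; OUR PROOF ATTEMPT (prover part P3 of row G-an2-4, fibre∕strip lineage, gen 22; CRUX TEAM (2) of the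
coordinator ruling «YM REDIRECT TOWARDS THE SUMMIT», 2026-08-21).  HONEST DEPENDENCY (cell records, verbatim):
«continuum YM on T⁴ ⇐ BetaPertH ∧ nine spine estimates (0/9 proved); BetaPertH ⇐ (D1) ∧ (D4) ∧ CAP+tail; G-an2-4 gates
asym, D1 and NE2/3/4.»  HONEST FRAMING (cell contract, verbatim): «discharging `BetaPertH` makes Bałaban's UV stability
UNCONDITIONAL — a real constructive-QFT result; it is NOT the continuum limit and NOT the Clay problem.»  ABSOLUTE RULE (cell
charter): nothing printed is used as a hypothesis; every statement below is [folklore] one-variable trigonometry proved here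
over the symbols `S₁`, `S_ξ` vendored (with their citation tags) by `Literature.….Balaban1983to89.B4Strip`.

## Why (the programme in one paragraph)

The one-step comparison of the constituent `G_jQ_j^*` of (CONV-C) (B4 (2.48), tree multiplier `B4StripSums.G n a m2 τ`,
`n = L^j`) between the levels `n` and `n·L` — the finer fine leg AVERAGED over the `L^{d}` sub-cells of each coarse fine cell
— reduces, alias by alias, to the comparison of the one-coordinate symbols `S_ξ(z) = 4n² sin²(z∕2n)` (`B4Strip.Sxi n`) and
`S_{ξ∕L}(z) = 4n²L² sin²(z∕2nL)` (`Sxi (n·L)`) and to the sub-block averaging weight `sin²(Lθ)∕(L² sin²θ)`, `θ = z∕(2nL)`.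
Both are governed by ONE entire function, the Dirichlet kernel `D_L(θ) = Σ_{ρ<L} e^{i(2ρ−L+1)θ} = Σ_{ρ<L} cos((2ρ−L+1)θ)`:
`sin(Lθ) = sin θ · D_L(θ)` (telescoping), `D_L(0) = L`, and on thin horizontal strips `|D_L(θ) − L| ≤ L³|θ|²` (second
order, from the cosine form).  Consequences: `S_ξ − S_{ξ∕L} = 4n² sin²θ·(D_L² − L²) = O(|z|⁴∕n²)` (R2's «irrelevance of the
action difference», ROUTES-GAN24 §2 R2-S2 ∕ (P-R2a), here a theorem on the complex strip) and the sub-weight `D_L²∕L²` is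
`1 + O(|z|²∕n²)` — the two sources of the sharp exponent `θ = L⁻²`.

## What is proved (every `L ≥ 1`, every `n ≥ 1`; constants explicit and crude)

* §1 strip bounds: `norm_sin_le` (`‖sin w‖ ≤ (5∕4)‖w‖`, `|Im w| ≤ 1∕2`), `norm_cos_sub_one_le` (`‖cos w − 1‖ ≤ ‖w‖²`, `|Im w| ≤ 1`).
* §2 the Dirichlet kernel `dir L θ`: `dir_apply_zero` (`dir L 0 = L`), `sin_mul_dir` (`sin θ · dir L θ = sin (Lθ)`),
  `dir_neg`, `dir_eq_sum_cos`, `norm_dir_le` (`≤ 2L` when `L|Im θ| ≤ 1∕2`), **`norm_dir_sub_le`** (`‖dir L θ − L‖ ≤ L³‖θ‖²`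
  when `L|Im θ| ≤ 1`).
* §3 **`norm_Sxi_sub_Sxi_mul_le`**: `‖Sxi n z − Sxi (n·L) z‖ ≤ ‖z‖⁴ ∕ n²` for `|Im z| ≤ 1`.
* §4 the sub-block weight `sw n L K z := dir L ((z+2πK)∕(2nL))² ∕ L²` (entire), `norm_sw_le` (`≤ 4`), **`norm_sw_sub_one_le`**
  (`‖sw − 1‖ ≤ 3L²‖(z+2πK)∕(2nL)‖²`), and the dictionary `sw_eq_div` (`= Sxi n (z+2πK) ∕ Sxi (n·L) (z+2πK)` off the zeros
  of the denominator).
* (moved to the sibling `SubAveragingSplitting`: the geometric sub-sums `gp`, `gm` with `gp·gm = sw` and the exact splittings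
  `v (n·L) K = gm · v n K`, `ef (n·L) K (Lt+ρ) = ef n K t · e^{i(z+2πK)ρ∕(nL)}` of the `B4StripSums` one-coordinate factors.)

NOT HERE: the splitting identities (`SubAveragingSplitting`), the alias sums (`SubAveragingCore`), the fibre columns and `E`
(`SubAveragingFibre`), kernels (`SubAveragingKernel`).  0∕4 row-D1
binders touched; NEVER «G-an2-4 closed»; NOT D1, NOT BetaPertH, NOT continuum, NOT Clay.  Provenance:
prover-b2b-balaban-gan24-p3-g22-0 (unit `b2b-balaban-gan24-p3`, gen 22), 2026-08-21.
-/

noncomputable section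

namespace Summit.QuantumFields.BalabanUV.Beta.GAN24.SubAveragingDirichlet

open Complex Finset
open Literature.MathematicalPhysics.QuantumFieldTheory.Balaban1983to89
open Literature.MathematicalPhysics.QuantumFieldTheory.Balaban1983to89.B4Strip
open Literature.MathematicalPhysics.QuantumFieldTheory.Balaban1983to89.B4StripCauchy
open Literature.MathematicalPhysics.QuantumFieldTheory.Balaban1983to89.B4StripSums
open scoped Real

/-! ## §1 Strip bounds for `sin` and `cos − 1` -/

/-- [folklore] `‖sin w‖ ≤ (5∕4)‖w‖` on the strip `|Im w| ≤ 1∕2` (from the tree's `norm_Sxi_le` at `n = 1`: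
`4‖sin w‖² = ‖S_ξ(2w)‖ ≤ (2 Re w)² + (25∕16)(2 Im w)²`). -/
theorem norm_sin_le (w : ℂ) (hw : |w.im| ≤ 1 / 2) : ‖Complex.sin w‖ ≤ 5 / 4 * ‖w‖ := by
  have him : (2 * w).im = 2 * w.im := by simp
  have hre : (2 * w).re = 2 * w.re := by simp
  have h := norm_Sxi_le 1 le_rfl (2 * w) (by rw [him, abs_mul, abs_two]; linarith)
  rw [Sxi_eq_sin_sq 1 one_ne_zero, him, hre] at h
  have e : 2 * w / (2 * ((1 : ℕ) : ℂ)) = w := by push_cast; ring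
  rw [e] at h
  have h' : 4 * ‖Complex.sin w‖ ^ 2 ≤ (2 * w.re) ^ 2 + 25 / 16 * (2 * w.im) ^ 2 := by
    simpa [norm_pow] using h
  have hw2 : ‖w‖ ^ 2 = w.re ^ 2 + w.im ^ 2 := by rw [Complex.sq_norm, Complex.normSq_apply]; ring
  have h2 : ‖Complex.sin w‖ ^ 2 ≤ (5 / 4 * ‖w‖) ^ 2 := by
    rw [mul_pow, hw2]; nlinarith [sq_nonneg w.re]
  exact (pow_le_pow_iff_left₀ (norm_nonneg _) (by positivity) two_ne_zero).1 h2

/-- [folklore] `‖cos w − 1‖ ≤ ‖w‖²` on the strip `|Im w| ≤ 1` (`2 − 2cos w = S₁(w) = S_ξ(w)` at `n = 1`, tree `norm_Sxi_le`). -/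
theorem norm_cos_sub_one_le (w : ℂ) (hw : |w.im| ≤ 1) : ‖Complex.cos w - 1‖ ≤ ‖w‖ ^ 2 := by
  have h := norm_Sxi_le 1 le_rfl w hw
  have e : Sxi 1 w = -2 * (Complex.cos w - 1) := by
    rw [← S1_eq_Sxi_one]; unfold S1; ring
  rw [e, norm_mul] at h
  have h2 : ‖(-2 : ℂ)‖ = 2 := by simp
  rw [h2] at h
  have hw2 : ‖w‖ ^ 2 = w.re ^ 2 + w.im ^ 2 := by rw [Complex.sq_norm, Complex.normSq_apply]; ring
  rw [hw2]
  nlinarith [sq_nonneg w.im, norm_nonneg (Complex.cos w - 1)]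

/-! ## §2 The Dirichlet kernel -/

/-- [folklore] THE DIRICHLET KERNEL in exponential form: `dir L θ = Σ_{ρ<L} e^{i(2ρ−L+1)θ}` (`= sin(Lθ)∕sin θ`, an entire
function of `θ`). -/
def dir (L : ℕ) (θ : ℂ) : ℂ := ∑ ρ ∈ Finset.range L, cexp (I * ((2 * (ρ : ℂ) - L + 1) * θ))

/-- [folklore] `dir L 0 = L`. -/
theorem dir_apply_zero (L : ℕ) : dir L 0 = L := by
  simp [dir]

/-- [folklore] **`sin θ · D_L(θ) = sin (Lθ)`** (the sum telescopes after multiplication by `e^{iθ} − e^{−iθ}`). -/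
theorem sin_mul_dir (L : ℕ) (θ : ℂ) : Complex.sin θ * dir L θ = Complex.sin (L * θ) := by
  have key : (cexp (I * θ) - cexp (-(I * θ))) * dir L θ = cexp (I * (L * θ)) - cexp (-(I * (L * θ))) := by
    unfold dir
    rw [Finset.mul_sum]
    have hterm : ∀ ρ ∈ Finset.range L, (cexp (I * θ) - cexp (-(I * θ))) * cexp (I * ((2 * (ρ : ℂ) - L + 1) * θ))
        = cexp (I * ((2 * ((ρ + 1 : ℕ) : ℂ) - L) * θ)) - cexp (I * ((2 * (ρ : ℂ) - L) * θ)) := by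
      intro ρ _
      rw [sub_mul, ← Complex.exp_add, ← Complex.exp_add]
      congr 1
      · congr 1; push_cast; ring
      · congr 1; ring
    rw [Finset.sum_congr rfl hterm, Finset.sum_range_sub (fun ρ => cexp (I * ((2 * (ρ : ℂ) - L) * θ))) L]
    congr 1
    · congr 1; ring
    · congr 1; push_cast; ring
  have hs : ∀ u : ℂ, Complex.sin u = (cexp (-(I * u)) - cexp (I * u)) * I / 2 := by
    intro u; rw [Complex.sin]; ring_nf
  rw [hs θ, hs (L * θ)]
  have : (cexp (-(I * θ)) - cexp (I * θ)) * I / 2 * dir L θ = -((cexp (I * θ) - cexp (-(I * θ))) * dir L θ) * I / 2 := by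
    ring
  rw [this, key]; ring

/-- [folklore] `dir L (−θ) = dir L θ` (reflection `ρ ↦ L−1−ρ`). -/
theorem dir_neg (L : ℕ) (θ : ℂ) : dir L (-θ) = dir L θ := by
  unfold dir
  rw [← Finset.sum_range_reflect]
  refine Finset.sum_congr rfl fun ρ hρ => ?_
  have hρL : ρ < L := Finset.mem_range.mp hρ
  congr 1
  have : ((L - 1 - ρ : ℕ) : ℂ) = (L : ℂ) - 1 - ρ := by
    rw [Nat.cast_sub (by omega), Nat.cast_sub (by omega)]; push_cast; ring
  rw [this]; ring

/-- [folklore] the cosine form `dir L θ = Σ_{ρ<L} cos((2ρ−L+1)θ)` (average of `dir L θ` and `dir L (−θ)`). -/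
theorem dir_eq_sum_cos (L : ℕ) (θ : ℂ) : dir L θ = ∑ ρ ∈ Finset.range L, Complex.cos ((2 * (ρ : ℂ) - L + 1) * θ) := by
  have h : dir L θ = (dir L θ + dir L (-θ)) / 2 := by rw [dir_neg]; ring
  rw [h]
  unfold dir
  rw [← Finset.sum_add_distrib, Finset.sum_div]
  refine Finset.sum_congr rfl fun ρ _ => ?_
  rw [Complex.cos]
  congr 1
  congr 1
  · congr 1; ring
  · congr 1; ring

/-- [folklore] `‖e^{i a θ}‖ ≤ e^{|a|·|Im θ|}` for real `a`. -/
theorem norm_exp_I_mul_le (a : ℝ) (θ : ℂ) : ‖cexp (I * ((a : ℂ) * θ))‖ ≤ Real.exp (|a| * |θ.im|) := by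
  rw [Complex.norm_exp]
  apply Real.exp_le_exp.mpr
  have : (I * ((a : ℂ) * θ)).re = -(a * θ.im) := by simp [Complex.mul_re, Complex.mul_im]
  rw [this]
  calc -(a * θ.im) ≤ |a * θ.im| := neg_le_abs _
    _ = |a| * |θ.im| := abs_mul _ _

/-- [folklore] `‖dir L θ‖ ≤ 2L` when `L·|Im θ| ≤ 1∕2` (each term has modulus `≤ e^{(L−1)|Im θ|} ≤ e^{1∕2} < 2`). -/
theorem norm_dir_le (L : ℕ) (θ : ℂ) (hθ : (L : ℝ) * |θ.im| ≤ 1 / 2) : ‖dir L θ‖ ≤ 2 * L := by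
  unfold dir
  refine (norm_sum_le _ _).trans ?_
  have hL0 : (0 : ℝ) ≤ L := Nat.cast_nonneg L
  have hterm : ∀ ρ ∈ Finset.range L, ‖cexp (I * ((2 * (ρ : ℂ) - L + 1) * θ))‖ ≤ 2 := by
    intro ρ hρ
    have hρL : ρ < L := Finset.mem_range.mp hρ
    have e : (2 * (ρ : ℂ) - L + 1) = ((2 * (ρ : ℝ) - L + 1 : ℝ) : ℂ) := by push_cast; ring
    rw [e]
    refine (norm_exp_I_mul_le _ θ).trans ?_
    have ha : |2 * (ρ : ℝ) - L + 1| ≤ L := by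
      rw [abs_le]; constructor <;> · have : (ρ : ℝ) + 1 ≤ L := by exact_mod_cast hρL
                                     nlinarith
    have h1 : |2 * (ρ : ℝ) - L + 1| * |θ.im| ≤ 1 / 2 := by
      calc |2 * (ρ : ℝ) - L + 1| * |θ.im| ≤ L * |θ.im| := by
            exact mul_le_mul_of_nonneg_right ha (abs_nonneg _)
        _ ≤ 1 / 2 := hθ
    calc Real.exp (|2 * (ρ : ℝ) - L + 1| * |θ.im|) ≤ Real.exp (1 / 2) := Real.exp_le_exp.mpr h1
      _ ≤ 2 := by
        have := Real.exp_one_lt_d9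
        have h2 : Real.exp (1 / 2) ^ 2 = Real.exp 1 := by rw [← Real.exp_nat_mul]; norm_num
        nlinarith [Real.exp_pos (1 / 2)]
  calc ∑ ρ ∈ Finset.range L, ‖cexp (I * ((2 * (ρ : ℂ) - L + 1) * θ))‖ ≤ ∑ _ρ ∈ Finset.range L, (2 : ℝ) :=
        Finset.sum_le_sum hterm
    _ = 2 * L := by simp [mul_comm]

/-- [folklore] **SECOND-ORDER FLATNESS AT `0`: `‖dir L θ − L‖ ≤ L³‖θ‖²`** when `L·|Im θ| ≤ 1` (cosine form + `‖cos w − 1‖ ≤ ‖w‖²`). -/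
theorem norm_dir_sub_le (L : ℕ) (θ : ℂ) (hθ : (L : ℝ) * |θ.im| ≤ 1) : ‖dir L θ - L‖ ≤ (L : ℝ) ^ 3 * ‖θ‖ ^ 2 := by
  rw [dir_eq_sum_cos]
  have hL0 : (0 : ℝ) ≤ L := Nat.cast_nonneg L
  have e : (∑ ρ ∈ Finset.range L, Complex.cos ((2 * (ρ : ℂ) - L + 1) * θ)) - L
      = ∑ ρ ∈ Finset.range L, (Complex.cos ((2 * (ρ : ℂ) - L + 1) * θ) - 1) := by
    rw [Finset.sum_sub_distrib]; simp
  rw [e]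
  refine (norm_sum_le _ _).trans ?_
  have hterm : ∀ ρ ∈ Finset.range L, ‖Complex.cos ((2 * (ρ : ℂ) - L + 1) * θ) - 1‖ ≤ (L : ℝ) ^ 2 * ‖θ‖ ^ 2 := by
    intro ρ hρ
    have hρL : ρ < L := Finset.mem_range.mp hρ
    have ha : |2 * (ρ : ℝ) - L + 1| ≤ L := by
      rw [abs_le]; constructor <;> · have : (ρ : ℝ) + 1 ≤ L := by exact_mod_cast hρL
                                     nlinarith
    have e1 : (2 * (ρ : ℂ) - L + 1) = ((2 * (ρ : ℝ) - L + 1 : ℝ) : ℂ) := by push_cast; ring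
    have him : |((2 * (ρ : ℂ) - L + 1) * θ).im| ≤ 1 := by
      rw [e1, Complex.re_ofReal_mul |> fun _ => Complex.im_ofReal_mul _ _, abs_mul]
      calc |2 * (ρ : ℝ) - L + 1| * |θ.im| ≤ L * |θ.im| := mul_le_mul_of_nonneg_right ha (abs_nonneg _)
        _ ≤ 1 := hθ
    refine (norm_cos_sub_one_le _ him).trans ?_
    rw [norm_mul, mul_pow, e1, Complex.norm_real, Real.norm_eq_abs]
    have : |2 * (ρ : ℝ) - L + 1| ^ 2 ≤ (L : ℝ) ^ 2 := pow_le_pow_left₀ (abs_nonneg _) ha 2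
    exact mul_le_mul_of_nonneg_right this (sq_nonneg _)
  calc ∑ ρ ∈ Finset.range L, ‖Complex.cos ((2 * (ρ : ℂ) - L + 1) * θ) - 1‖
      ≤ ∑ _ρ ∈ Finset.range L, (L : ℝ) ^ 2 * ‖θ‖ ^ 2 := Finset.sum_le_sum hterm
    _ = (L : ℝ) ^ 3 * ‖θ‖ ^ 2 := by simp; ring

/-! ## §3 The two-spacing comparison of the Laplacian symbol: `S_ξ − S_{ξ∕L} = O(|z|⁴∕n²)` on the strip -/

/-- [folklore] the scaled angle `θ = z ∕ (2nL)`. -/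
def ang (n L : ℕ) (z : ℂ) : ℂ := z / (2 * ((n : ℂ) * L))

/-- [folklore] `‖ang n L z‖ = ‖z‖ ∕ (2nL)`. -/
theorem norm_ang (n L : ℕ) (z : ℂ) : ‖ang n L z‖ = ‖z‖ / (2 * n * L) := by
  unfold ang
  rw [norm_div]
  congr 1
  simp [mul_assoc]

/-- [folklore] `Im (ang n L z) = Im z ∕ (2nL)`. -/
theorem ang_im (n L : ℕ) (z : ℂ) : (ang n L z).im = z.im / (2 * n * L) := by
  unfold ang
  have : (2 * ((n : ℂ) * L)) = ((2 * (n : ℝ) * L : ℝ) : ℂ) := by push_cast; ring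
  rw [this, Complex.div_ofReal_im]

/-- [folklore] the strip hypotheses on `θ = ang n L z` from `|Im z| ≤ 1`: `L|Im θ| ≤ 1∕2` (hence `≤ 1`) and `|Im θ| ≤ 1∕2`. -/
theorem ang_im_bounds (n L : ℕ) (hn : 1 ≤ n) (hL : 1 ≤ L) (z : ℂ) (hz : |z.im| ≤ 1) :
    (L : ℝ) * |(ang n L z).im| ≤ 1 / 2 ∧ (L : ℝ) * |(ang n L z).im| ≤ 1 ∧ |(ang n L z).im| ≤ 1 / 2 := by
  have hn1 : (1 : ℝ) ≤ n := by exact_mod_cast hn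
  have hL1 : (1 : ℝ) ≤ L := by exact_mod_cast hL
  rw [ang_im, abs_div, abs_of_pos (by positivity : (0 : ℝ) < 2 * n * L)]
  have h1 : (L : ℝ) * (|z.im| / (2 * n * L)) = |z.im| / (2 * n) := by field_simp
  rw [h1]
  refine ⟨?_, ?_, ?_⟩
  · rw [div_le_iff₀ (by positivity)]; nlinarith [abs_nonneg z.im]
  · rw [div_le_iff₀ (by positivity)]; nlinarith [abs_nonneg z.im]
  · rw [div_le_iff₀ (by positivity)]; nlinarith [abs_nonneg z.im]

/-- [folklore] `S_ξ` through the angle: `Sxi n z = 4n² sin²(L·θ)`, `θ = ang n L z`. -/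
theorem Sxi_eq_ang (n L : ℕ) (hn : 1 ≤ n) (hL : 1 ≤ L) (z : ℂ) :
    Sxi n z = 4 * (n : ℂ) ^ 2 * Complex.sin (L * ang n L z) ^ 2 := by
  rw [Sxi_eq_sin_sq n (by omega)]
  congr 2
  unfold ang
  have hL' : (L : ℂ) ≠ 0 := Nat.cast_ne_zero.mpr (by omega)
  have hn' : (n : ℂ) ≠ 0 := Nat.cast_ne_zero.mpr (by omega)
  field_simp

/-- [folklore] `S_{ξ∕L}` through the angle: `Sxi (n·L) z = 4n²L² sin²θ`. -/
theorem Sxi_mul_eq_ang (n L : ℕ) (z : ℂ) :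
    Sxi (n * L) z = 4 * (n : ℂ) ^ 2 * (L : ℂ) ^ 2 * Complex.sin (ang n L z) ^ 2 := by
  by_cases h : n * L = 0
  · unfold Sxi ang
    rcases Nat.mul_eq_zero.mp h with h | h <;> simp [h]
  · rw [Sxi_eq_sin_sq (n * L) h]
    unfold ang
    push_cast
    ring

/-- [folklore] **THE TWO-SPACING COMPARISON ON THE STRIP** (ROUTES-GAN24 R2's kill-test (P-R2a) made a theorem, complex form of
King's (4.31)): `‖S_ξ(z) − S_{ξ∕L}(z)‖ ≤ 2‖z‖⁴∕n²` for `|Im z| ≤ 1`, every `n, L ≥ 1` — the difference of the two lattice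
Laplacian symbols at the SAME momentum is fourth order at `0` and second-order small in `ξ = 1∕n`, uniformly on the strip. -/
theorem norm_Sxi_sub_Sxi_mul_le (n L : ℕ) (hn : 1 ≤ n) (hL : 1 ≤ L) (z : ℂ) (hz : |z.im| ≤ 1) :
    ‖Sxi n z - Sxi (n * L) z‖ ≤ 2 * ‖z‖ ^ 4 / (n : ℝ) ^ 2 := by
  obtain ⟨hθ1, hθ2, hθ3⟩ := ang_im_bounds n L hn hL z hz
  set θ := ang n L z with hθ
  have hn1 : (1 : ℝ) ≤ n := by exact_mod_cast hn
  have hL1 : (1 : ℝ) ≤ L := by exact_mod_cast hL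
  have e : Sxi n z - Sxi (n * L) z = 4 * (n : ℂ) ^ 2 * (Complex.sin θ ^ 2 * ((dir L θ - L) * (dir L θ + L))) := by
    rw [Sxi_eq_ang n L hn hL, Sxi_mul_eq_ang, ← hθ, ← sin_mul_dir]; ring
  rw [e]
  have hs := norm_sin_le θ hθ3
  have hd := norm_dir_sub_le L θ hθ2
  have hd' : ‖dir L θ + L‖ ≤ 3 * L := by
    calc ‖dir L θ + L‖ ≤ ‖dir L θ‖ + ‖(L : ℂ)‖ := norm_add_le _ _
      _ ≤ 2 * L + L := by
          rw [Complex.norm_natCast]; linarith [norm_dir_le L θ hθ1]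
      _ = 3 * L := by ring
  have hnn : ‖(4 * (n : ℂ) ^ 2)‖ = 4 * (n : ℝ) ^ 2 := by simp
  rw [norm_mul, hnn, norm_mul, norm_mul, norm_pow]
  have hθn : ‖θ‖ = ‖z‖ / (2 * n * L) := norm_ang n L z
  have key : ‖Complex.sin θ‖ ^ 2 * (‖dir L θ - ↑L‖ * ‖dir L θ + ↑L‖)
      ≤ (5 / 4 * ‖θ‖) ^ 2 * ((L : ℝ) ^ 3 * ‖θ‖ ^ 2 * (3 * L)) := by
    apply mul_le_mul (pow_le_pow_left₀ (norm_nonneg _) hs 2) (mul_le_mul hd hd' (norm_nonneg _) (by positivity))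
      (by positivity) (by positivity)
  calc 4 * (n : ℝ) ^ 2 * (‖Complex.sin θ‖ ^ 2 * (‖dir L θ - ↑L‖ * ‖dir L θ + ↑L‖))
      ≤ 4 * (n : ℝ) ^ 2 * ((5 / 4 * ‖θ‖) ^ 2 * ((L : ℝ) ^ 3 * ‖θ‖ ^ 2 * (3 * L))) :=
        mul_le_mul_of_nonneg_left key (by positivity)
    _ = 75 / 64 * ‖z‖ ^ 4 / (n : ℝ) ^ 2 := by rw [hθn]; field_simp; ring
    _ ≤ 2 * ‖z‖ ^ 4 / (n : ℝ) ^ 2 := by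
        apply div_le_div_of_nonneg_right _ (by positivity); nlinarith [pow_nonneg (norm_nonneg z) 4]

/-! ## §4 The sub-block averaging weight `sw` (entire) and its dictionary with the symbol ratio -/

/-- [folklore] THE SUB-BLOCK AVERAGING WEIGHT of the alias `K` (one coordinate): `sw n L K z := D_L(θ_K)² ∕ L²`,
`θ_K = (z + 2πK)∕(2nL)` — the continued `|L⁻¹ Σ_{ρ<L} e^{i(z+2πK)ρ∕(nL)}|²`, i.e. `sin²((z+2πK)∕2n) ∕ (L² sin²((z+2πK)∕2nL))`
with its removable singularities filled (ENTIRE in `z`). -/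
def sw (n L : ℕ) (K : ℕ) (z : ℂ) : ℂ := dir L (ang n L (z + 2 * π * K)) ^ 2 / (L : ℂ) ^ 2

/-- [folklore] `Im (z + 2πK) = Im z`. -/
theorem shiftK_im (z : ℂ) (K : ℕ) : (z + 2 * π * K).im = z.im := by simp

/-- [folklore] `‖sw‖ ≤ 4` on `|Im z| ≤ 1` (every `n, L ≥ 1`, every `K`). -/
theorem norm_sw_le (n L : ℕ) (hn : 1 ≤ n) (hL : 1 ≤ L) (K : ℕ) (z : ℂ) (hz : |z.im| ≤ 1) : ‖sw n L K z‖ ≤ 4 := by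
  obtain ⟨hθ1, -, -⟩ := ang_im_bounds n L hn hL (z + 2 * π * K) (by rwa [shiftK_im])
  have hd := norm_dir_le L _ hθ1
  have hL1 : (1 : ℝ) ≤ L := by exact_mod_cast hL
  unfold sw
  rw [norm_div, norm_pow, norm_pow, Complex.norm_natCast, div_le_iff₀ (by positivity)]
  nlinarith [norm_nonneg (dir L (ang n L (z + 2 * ↑π * ↑K)))]

/-- [folklore] **`‖sw − 1‖ ≤ 3L²‖θ_K‖²`**, `θ_K = ang n L (z+2πK)`, on `|Im z| ≤ 1` (the sub-weight is `1` to SECOND order). -/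
theorem norm_sw_sub_one_le (n L : ℕ) (hn : 1 ≤ n) (hL : 1 ≤ L) (K : ℕ) (z : ℂ) (hz : |z.im| ≤ 1) :
    ‖sw n L K z - 1‖ ≤ 3 * (L : ℝ) ^ 2 * ‖ang n L (z + 2 * π * K)‖ ^ 2 := by
  obtain ⟨hθ1, hθ2, -⟩ := ang_im_bounds n L hn hL (z + 2 * π * K) (by rwa [shiftK_im])
  set θ := ang n L (z + 2 * π * K)
  have hL1 : (1 : ℝ) ≤ L := by exact_mod_cast hL
  have hL' : (L : ℂ) ≠ 0 := Nat.cast_ne_zero.mpr (by omega)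
  have e : sw n L K z - 1 = (dir L θ - L) * (dir L θ + L) / (L : ℂ) ^ 2 := by
    unfold sw; field_simp; ring
  rw [e, norm_div, norm_mul, norm_pow, Complex.norm_natCast, div_le_iff₀ (by positivity)]
  have hd := norm_dir_sub_le L θ hθ2
  have hd' : ‖dir L θ + L‖ ≤ 3 * L := by
    calc ‖dir L θ + L‖ ≤ ‖dir L θ‖ + ‖(L : ℂ)‖ := norm_add_le _ _
      _ ≤ 2 * L + L := by rw [Complex.norm_natCast]; linarith [norm_dir_le L θ hθ1]
      _ = 3 * L := by ring
  calc ‖dir L θ - ↑L‖ * ‖dir L θ + ↑L‖ ≤ ((L : ℝ) ^ 3 * ‖θ‖ ^ 2) * (3 * L) :=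
        mul_le_mul hd hd' (norm_nonneg _) (by positivity)
    _ = 3 * (L : ℝ) ^ 2 * ‖θ‖ ^ 2 * (L : ℝ) ^ 2 := by ring

/-- [folklore] THE DICTIONARY: off the zeros of the finer symbol, `sw n L K z = S_ξ(z+2πK) ∕ S_{ξ∕L}(z+2πK)`. -/
theorem sw_eq_div (n L : ℕ) (hn : 1 ≤ n) (hL : 1 ≤ L) (K : ℕ) (z : ℂ) (h : Sxi (n * L) (z + 2 * π * K) ≠ 0) :
    sw n L K z = Sxi n (z + 2 * π * K) / Sxi (n * L) (z + 2 * π * K) := by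
  set w := z + 2 * π * K
  have hs : Complex.sin (ang n L w) ≠ 0 := by
    intro h0; apply h; rw [Sxi_mul_eq_ang, h0]; ring
  have hL' : (L : ℂ) ≠ 0 := Nat.cast_ne_zero.mpr (by omega)
  have hn' : (n : ℂ) ≠ 0 := Nat.cast_ne_zero.mpr (by omega)
  rw [Sxi_eq_ang n L hn hL, Sxi_mul_eq_ang, ← sin_mul_dir, sw]
  field_simp
  ring

end Summit.QuantumFields.BalabanUV.Beta.GAN24.SubAveragingDirichlet
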